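import Summits.QuantumFields.YangMills.Theorems.UnitScaleTiltProp7CovLogTowerOfRegPrT3
import HarnessLib

/-!
# Route `UnitScaleTilt`, crux K1 «MinimiserStabilityRegPr» (stmt-QuantumFields-19200), route-R E′ (A′) P-A2 «JOINT-Σ», row F0″ — v1.1 companion: **THE ℓ¹ DAMPED BOUND OF THE TWISTED CHART
# REMAINDER WITH LEVEL-DEPENDENT COLUMN-SUM LETTERS `κ_m`** (routeR-w1 g8's located point 2026-08-29T03:05:43Z: at a CURVED background F2″-COV supplies `κ_l = (L²)⁻¹·(1 + x_l)` with
# `x_l > 0`, so the T³ rows ✓`l1_CmapTwS_le_damped_defects`∕`…_of_regPr` (one uniform `κ`) must be accompanied by the PRODUCT form `Π_{l<l′<K−n} κ_{l′}` that F4″'s damping-product bridge reads;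
# ✓`IteratedMapTelescope.l1_orbit_sub_lin_le_of_lt` (v1.1 ✓p689837) is the lattice-free letter)

Cell `ym3-torus` (HUMAN RULING D-0037: YM₃ on the torus is ladder rung R3 — not d = 4, not a mass gap, not Clay), width seat `ym3-torus-px18` (gen 3).  `--supports stmt-QuantumFields-19200 --as
helper`; THEOREMS ONLY (0 `def`, 0 `sorry`); count-neutral.  A separate small file (the parent files are at the 400-line budget); nothing of P-A2, hcoW, E′, EX, the crux or the gap is claimed.

WHAT IS PROVED (same letters as ✓`Prop7CovLogTower`∕✓`Prop7CovLogTowerOfRegPr`: `U₀♭ = bgUnits F K U₀`, `V_m = emlIterU m U₀♭`, `Φ_{V_m}` the INLINE one-step log map, `ĉ = bondShift (sites_eq …) c`).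
* ★★★ `l1_CmapTwS_le_damped_defects_prod` — F0″-b's damped bound with `κ : ℕ → ℝ`, `hT : ∀ m < K−n, Σ_c‖fderiv Φ_{V_m} 0 v c‖ ≤ κ m·Σ‖v‖`, conclusion
  `Σ_c ‖C^{twS}(X)(c)‖ ≤ Σ_{l<K−n} (Π_{l′∈Ico (l+1) (K−n)} κ l′)·Σ_{c′}‖(Φ_{V_l}(F_l X) − T_l(F_l X)) c′‖` (windows displayed as in F0″-b).
* ★★★ `l1_CmapTwS_le_damped_defects_prod_of_regPr` — the same with the windows DISCHARGED from `RegPr` + `10⁹L²e ≤ 1`, `10¹²L³ε₀ ≤ 1` (F0″-c's suppliers).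

References: T. Bałaban, CMP **98** (1985) 17–51 [Balaban1985Averaging] ((150)–(152) pp.40–41); CMP **102** (1985) 277–309 [Balaban1985Variational] ((44) p.285).
-/

set_option autoImplicit false

noncomputable section

open scoped BigOperators Matrix.Norms.L2Operator

namespace Summit.QuantumFields.YangMills.Theorems.Prop7CovLogTowerProd

open NormedSpace
open Literature.MathematicalPhysics.QuantumFieldTheory.Balaban1983to89
open Literature.MathematicalPhysics.QuantumFieldTheory.Balaban1983to89.T3ContinuumYM3Torus
open T4Continuum BlockAveraging AveragingRT ExpMeanLog
open MatrixLog (mlog)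
open B7Prop1Explicit (expUnit)
open T3PrintedRegularMinimiser (RegPr)
open T3SectALandauChart (eta eta_pos bgUnits)
open T3LevelShift (bondShift)
open T3PrintedRegularOrbits (sites_eq)
open Summit.QuantumFields.YangMills.Theorems.Prop8Chart (emlAvgU emlIterU)
open Summit.QuantumFields.YangMills.Theorems.Prop7SymAvgTwSym (dbarCovU dbarCovIterU CmapTwS)
open Summit.QuantumFields.YangMills.Theorems.IteratedMapTelescope (l1_orbit_sub_lin_le_of_lt)
open Summit.QuantumFields.YangMills.Theorems.Prop7CovLogTower (CmapTwS_apply_eq_iterate_sub_lin)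
open Summit.QuantumFields.YangMills.Theorems.Prop7DbarTwSymWindow (windows_of_numerals)
open Summit.QuantumFields.YangMills.Theorems.Prop7CovLogTowerOfRegPr (hwinr_of_regPr differentiableAt_phiCov_zero_of_regPr)

section Displayed

variable (F : T3Family) (n K : ℕ) (h : n ≤ K) (U₀ : GaugeField (F.P K) 0 (Matrix.specialUnitaryGroup (Fin 2) ℂ))

/-- ★★★ **F0″ — ℓ¹ DAMPED FORM WITH LEVEL-DEPENDENT LETTERS `κ_m`** (routeR-w1 g8's located point 2026-08-29T03:05:43Z: at a curved background F2″-COV supplies `κ_l = (L²)⁻¹(1 + x_l)`,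
so the T³ row must carry the PRODUCT `Π_{l<l′<K−n} κ_{l′}`, not a uniform power; windows displayed as in ✓F0″-b): `Σ_c ‖C^{twS}(X)(c)‖ ≤ Σ_{l<K−n} (Π_{l′∈[l+1,K−n)} κ_{l′})·Σ_{c′}‖(Φ_{V_l}(F_l X) − T_l(F_l X)) c′‖`
(✓`IteratedMapTelescope.l1_orbit_sub_lin_le_of_lt`). [cite: Balaban1985Averaging, (150)–(152) pp.40–41; Balaban1985Variational, (44) p.285] -/
theorem l1_CmapTwS_le_damped_defects_prod
    (Fm : (m : ℕ) → (PBond (F.P K) 0 → Matrix (Fin 2) (Fin 2) ℂ) → (PBond (F.P K) m → Matrix (Fin 2) (Fin 2) ℂ)) (hF0 : ∀ x, Fm 0 x = x)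
    (hFs : ∀ (m : ℕ) (x : PBond (F.P K) 0 → Matrix (Fin 2) (Fin 2) ℂ), Fm (m + 1) x =
        (fun y : PBond (F.P K) m → Matrix (Fin 2) (Fin 2) ℂ => fun c : PBond (F.P K) (m + 1) =>
          mlog (((dbarCovU (emlIterU m (bgUnits F K U₀)) (fun b => expUnit (y b) * emlIterU m (bgUnits F K U₀) b) c : (Matrix (Fin 2) (Fin 2) ℂ)ˣ) : Matrix (Fin 2) (Fin 2) ℂ) *
            (((emlAvgU (emlIterU m (bgUnits F K U₀)) c)⁻¹ : (Matrix (Fin 2) (Fin 2) ℂ)ˣ) : Matrix (Fin 2) (Fin 2) ℂ))) (Fm m x))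
    (Lin : (m : ℕ) → (PBond (F.P K) 0 → Matrix (Fin 2) (Fin 2) ℂ) →L[ℂ] (PBond (F.P K) m → Matrix (Fin 2) (Fin 2) ℂ))
    (hLin0 : Lin 0 = ContinuousLinearMap.id ℂ (PBond (F.P K) 0 → Matrix (Fin 2) (Fin 2) ℂ))
    (hLins : ∀ m : ℕ, Lin (m + 1) =
        (fderiv ℂ (fun y : PBond (F.P K) m → Matrix (Fin 2) (Fin 2) ℂ => fun c : PBond (F.P K) (m + 1) =>
          mlog (((dbarCovU (emlIterU m (bgUnits F K U₀)) (fun b => expUnit (y b) * emlIterU m (bgUnits F K U₀) b) c : (Matrix (Fin 2) (Fin 2) ℂ)ˣ) : Matrix (Fin 2) (Fin 2) ℂ) *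
            (((emlAvgU (emlIterU m (bgUnits F K U₀)) c)⁻¹ : (Matrix (Fin 2) (Fin 2) ℂ)ˣ) : Matrix (Fin 2) (Fin 2) ℂ))) 0).comp (Lin m))
    {r : ℝ} (hr : 0 < r)
    (hwinr : ∀ X : PBond (F.P K) 0 → Matrix (Fin 2) (Fin 2) ℂ, ‖X‖ < r → (∀ b, ‖X b‖ ≤ 1 / 5) ∧ ∀ m, m < K - n → ∀ b : PBond (F.P K) m,
      ‖((dbarCovIterU m (bgUnits F K U₀) (fun b' => expUnit (X b') * bgUnits F K U₀ b') b : (Matrix (Fin 2) (Fin 2) ℂ)ˣ) : Matrix (Fin 2) (Fin 2) ℂ) *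
          (((emlIterU m (bgUnits F K U₀) b)⁻¹ : (Matrix (Fin 2) (Fin 2) ℂ)ˣ) : Matrix (Fin 2) (Fin 2) ℂ) - 1‖ < 1)
    (hdiff : ∀ m, m < K - n → DifferentiableAt ℂ (fun y : PBond (F.P K) m → Matrix (Fin 2) (Fin 2) ℂ => fun c : PBond (F.P K) (m + 1) =>
          mlog (((dbarCovU (emlIterU m (bgUnits F K U₀)) (fun b => expUnit (y b) * emlIterU m (bgUnits F K U₀) b) c : (Matrix (Fin 2) (Fin 2) ℂ)ˣ) : Matrix (Fin 2) (Fin 2) ℂ) *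
            (((emlAvgU (emlIterU m (bgUnits F K U₀)) c)⁻¹ : (Matrix (Fin 2) (Fin 2) ℂ)ˣ) : Matrix (Fin 2) (Fin 2) ℂ))) 0)
    (κ : ℕ → ℝ) (hκ : ∀ m : ℕ, m < K - n → 0 ≤ κ m)
    (hT : ∀ m : ℕ, m < K - n → ∀ v : PBond (F.P K) m → Matrix (Fin 2) (Fin 2) ℂ, ∑ c, ‖fderiv ℂ (fun y : PBond (F.P K) m → Matrix (Fin 2) (Fin 2) ℂ => fun c : PBond (F.P K) (m + 1) =>
          mlog (((dbarCovU (emlIterU m (bgUnits F K U₀)) (fun b => expUnit (y b) * emlIterU m (bgUnits F K U₀) b) c : (Matrix (Fin 2) (Fin 2) ℂ)ˣ) : Matrix (Fin 2) (Fin 2) ℂ) *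
            (((emlAvgU (emlIterU m (bgUnits F K U₀)) c)⁻¹ : (Matrix (Fin 2) (Fin 2) ℂ)ˣ) : Matrix (Fin 2) (Fin 2) ℂ))) 0 v c‖ ≤ κ m * ∑ c', ‖v c'‖)
    (X : PBond (F.P K) 0 → Matrix (Fin 2) (Fin 2) ℂ) (hXr : ‖X‖ < r) :
    ∑ c : PBond (F.P n) 0, ‖CmapTwS F n K h U₀ X c‖ ≤
      ∑ l ∈ Finset.range (K - n), (∏ l' ∈ Finset.Ico (l + 1) (K - n), κ l') * ∑ c', ‖((fun y : PBond (F.P K) l → Matrix (Fin 2) (Fin 2) ℂ => fun c : PBond (F.P K) (l + 1) =>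
          mlog (((dbarCovU (emlIterU l (bgUnits F K U₀)) (fun b => expUnit (y b) * emlIterU l (bgUnits F K U₀) b) c : (Matrix (Fin 2) (Fin 2) ℂ)ˣ) : Matrix (Fin 2) (Fin 2) ℂ) *
            (((emlAvgU (emlIterU l (bgUnits F K U₀)) c)⁻¹ : (Matrix (Fin 2) (Fin 2) ℂ)ˣ) : Matrix (Fin 2) (Fin 2) ℂ))) (Fm l X) -
        fderiv ℂ (fun y : PBond (F.P K) l → Matrix (Fin 2) (Fin 2) ℂ => fun c : PBond (F.P K) (l + 1) =>
          mlog (((dbarCovU (emlIterU l (bgUnits F K U₀)) (fun b => expUnit (y b) * emlIterU l (bgUnits F K U₀) b) c : (Matrix (Fin 2) (Fin 2) ℂ)ˣ) : Matrix (Fin 2) (Fin 2) ℂ) *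
            (((emlAvgU (emlIterU l (bgUnits F K U₀)) c)⁻¹ : (Matrix (Fin 2) (Fin 2) ℂ)ˣ) : Matrix (Fin 2) (Fin 2) ℂ))) 0 (Fm l X)) c'‖ := by
  -- re-index the left side along `bondShift : PBond (F.P n) 0 ≃ PBond (F.P K) (K − n)` and rewrite each summand by §3's exact identity
  have hsum : ∑ c : PBond (F.P n) 0, ‖CmapTwS F n K h U₀ X c‖ = ∑ c' : PBond (F.P K) (K - n), ‖(Fm (K - n) X - Lin (K - n) X) c'‖ :=
    Fintype.sum_equiv (bondShift (sites_eq F n K h)) _ _ fun c => by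
      rw [CmapTwS_apply_eq_iterate_sub_lin F n K h U₀ Fm hF0 hFs Lin hLin0 hLins hr hwinr hdiff X hXr c]
  rw [hsum]
  have h := l1_orbit_sub_lin_le_of_lt (fun m => PBond (F.P K) m)
    (fun m => fun y : PBond (F.P K) m → Matrix (Fin 2) (Fin 2) ℂ => fun c : PBond (F.P K) (m + 1) =>
          mlog (((dbarCovU (emlIterU m (bgUnits F K U₀)) (fun b => expUnit (y b) * emlIterU m (bgUnits F K U₀) b) c : (Matrix (Fin 2) (Fin 2) ℂ)ˣ) : Matrix (Fin 2) (Fin 2) ℂ) *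
            (((emlAvgU (emlIterU m (bgUnits F K U₀)) c)⁻¹ : (Matrix (Fin 2) (Fin 2) ℂ)ˣ) : Matrix (Fin 2) (Fin 2) ℂ)))
    (fun m => fderiv ℂ (fun y : PBond (F.P K) m → Matrix (Fin 2) (Fin 2) ℂ => fun c : PBond (F.P K) (m + 1) =>
          mlog (((dbarCovU (emlIterU m (bgUnits F K U₀)) (fun b => expUnit (y b) * emlIterU m (bgUnits F K U₀) b) c : (Matrix (Fin 2) (Fin 2) ℂ)ˣ) : Matrix (Fin 2) (Fin 2) ℂ) *
            (((emlAvgU (emlIterU m (bgUnits F K U₀)) c)⁻¹ : (Matrix (Fin 2) (Fin 2) ℂ)ˣ) : Matrix (Fin 2) (Fin 2) ℂ))) 0)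
    Lin hLin0 hLins (fun m => Fm m X) (fun m => hFs m X) (K - n) κ hκ hT
  rwa [hF0] at h


end Displayed

section OfRegPr

variable (F : T3Family) (n K : ℕ) (h : n ≤ K)

/-- ★★★ **P-A2 F0″ WITH THE WINDOWS DISCHARGED, LEVEL-DEPENDENT LETTERS `κ_m`** (routeR-w1 g8's located point: F2″-COV's `κ_l = (L²)⁻¹(1 + x_l)` at curved backgrounds ⇒ the
damping is the PRODUCT `Π κ_{l′}`). [cite: Balaban1985Averaging, (150)–(152) pp.40–41; Balaban1985Variational, (44) p.285] -/
theorem l1_CmapTwS_le_damped_defects_prod_of_regPr {ε₀ e : ℝ} (hε₀ : 0 < ε₀) (he : 0 < e) (hWe : 10 ^ 9 * (F.L : ℝ) ^ 2 * e ≤ 1) (hWε : 10 ^ 12 * (F.L : ℝ) ^ 3 * ε₀ ≤ 1)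
    (U₀ : GaugeField (F.P K) 0 (Matrix.specialUnitaryGroup (Fin 2) ℂ)) (hreg : RegPr F n K ε₀ U₀)
    (Fm : (m : ℕ) → (PBond (F.P K) 0 → Matrix (Fin 2) (Fin 2) ℂ) → (PBond (F.P K) m → Matrix (Fin 2) (Fin 2) ℂ)) (hF0 : ∀ x, Fm 0 x = x)
    (hFs : ∀ (m : ℕ) (x : PBond (F.P K) 0 → Matrix (Fin 2) (Fin 2) ℂ), Fm (m + 1) x =
        (fun y : PBond (F.P K) m → Matrix (Fin 2) (Fin 2) ℂ => fun c : PBond (F.P K) (m + 1) =>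
          mlog (((dbarCovU (emlIterU m (bgUnits F K U₀)) (fun b => expUnit (y b) * emlIterU m (bgUnits F K U₀) b) c : (Matrix (Fin 2) (Fin 2) ℂ)ˣ) : Matrix (Fin 2) (Fin 2) ℂ) *
            (((emlAvgU (emlIterU m (bgUnits F K U₀)) c)⁻¹ : (Matrix (Fin 2) (Fin 2) ℂ)ˣ) : Matrix (Fin 2) (Fin 2) ℂ))) (Fm m x))
    (Lin : (m : ℕ) → (PBond (F.P K) 0 → Matrix (Fin 2) (Fin 2) ℂ) →L[ℂ] (PBond (F.P K) m → Matrix (Fin 2) (Fin 2) ℂ))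
    (hLin0 : Lin 0 = ContinuousLinearMap.id ℂ (PBond (F.P K) 0 → Matrix (Fin 2) (Fin 2) ℂ))
    (hLins : ∀ m : ℕ, Lin (m + 1) =
        (fderiv ℂ (fun y : PBond (F.P K) m → Matrix (Fin 2) (Fin 2) ℂ => fun c : PBond (F.P K) (m + 1) =>
          mlog (((dbarCovU (emlIterU m (bgUnits F K U₀)) (fun b => expUnit (y b) * emlIterU m (bgUnits F K U₀) b) c : (Matrix (Fin 2) (Fin 2) ℂ)ˣ) : Matrix (Fin 2) (Fin 2) ℂ) *
            (((emlAvgU (emlIterU m (bgUnits F K U₀)) c)⁻¹ : (Matrix (Fin 2) (Fin 2) ℂ)ˣ) : Matrix (Fin 2) (Fin 2) ℂ))) 0).comp (Lin m))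
    (κ : ℕ → ℝ) (hκ : ∀ m : ℕ, m < K - n → 0 ≤ κ m)
    (hT : ∀ m : ℕ, m < K - n → ∀ v : PBond (F.P K) m → Matrix (Fin 2) (Fin 2) ℂ, ∑ c, ‖fderiv ℂ (fun y : PBond (F.P K) m → Matrix (Fin 2) (Fin 2) ℂ => fun c : PBond (F.P K) (m + 1) =>
          mlog (((dbarCovU (emlIterU m (bgUnits F K U₀)) (fun b => expUnit (y b) * emlIterU m (bgUnits F K U₀) b) c : (Matrix (Fin 2) (Fin 2) ℂ)ˣ) : Matrix (Fin 2) (Fin 2) ℂ) *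
            (((emlAvgU (emlIterU m (bgUnits F K U₀)) c)⁻¹ : (Matrix (Fin 2) (Fin 2) ℂ)ˣ) : Matrix (Fin 2) (Fin 2) ℂ))) 0 v c‖ ≤ κ m * ∑ c', ‖v c'‖)
    (X : PBond (F.P K) 0 → Matrix (Fin 2) (Fin 2) ℂ) (hXr : ‖X‖ < e * eta F n K) :
    ∑ c : PBond (F.P n) 0, ‖CmapTwS F n K h U₀ X c‖ ≤
      ∑ l ∈ Finset.range (K - n), (∏ l' ∈ Finset.Ico (l + 1) (K - n), κ l') * ∑ c', ‖((fun y : PBond (F.P K) l → Matrix (Fin 2) (Fin 2) ℂ => fun c : PBond (F.P K) (l + 1) =>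
          mlog (((dbarCovU (emlIterU l (bgUnits F K U₀)) (fun b => expUnit (y b) * emlIterU l (bgUnits F K U₀) b) c : (Matrix (Fin 2) (Fin 2) ℂ)ˣ) : Matrix (Fin 2) (Fin 2) ℂ) *
            (((emlAvgU (emlIterU l (bgUnits F K U₀)) c)⁻¹ : (Matrix (Fin 2) (Fin 2) ℂ)ˣ) : Matrix (Fin 2) (Fin 2) ℂ))) (Fm l X) -
        fderiv ℂ (fun y : PBond (F.P K) l → Matrix (Fin 2) (Fin 2) ℂ => fun c : PBond (F.P K) (l + 1) =>
          mlog (((dbarCovU (emlIterU l (bgUnits F K U₀)) (fun b => expUnit (y b) * emlIterU l (bgUnits F K U₀) b) c : (Matrix (Fin 2) (Fin 2) ℂ)ˣ) : Matrix (Fin 2) (Fin 2) ℂ) *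
            (((emlAvgU (emlIterU l (bgUnits F K U₀)) c)⁻¹ : (Matrix (Fin 2) (Fin 2) ℂ)ˣ) : Matrix (Fin 2) (Fin 2) ℂ))) 0 (Fm l X)) c'‖ := by
  have hε7 : 10 ^ 7 * (F.L : ℝ) ^ 3 * ε₀ ≤ 1 := (windows_of_numerals F hε₀.le he.le hWe hWε).2.1
  exact l1_CmapTwS_le_damped_defects_prod F n K h U₀ Fm hF0 hFs Lin hLin0 hLins (mul_pos he (eta_pos F n K))
    (hwinr_of_regPr F n K hε₀ he.le hWe hWε U₀ hreg) (fun m hm => differentiableAt_phiCov_zero_of_regPr F hε₀ hε7 U₀ hreg hm) κ hκ hT X hXr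

end OfRegPr

end Summit.QuantumFields.YangMills.Theorems.Prop7CovLogTowerProd

end
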